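import Literature.MathematicalPhysics.QuantumFieldTheory.Balaban1983to89.B9Eq336GaugeOrbitConnectedZd
import Literature.MathematicalPhysics.QuantumFieldTheory.Balaban1983to89.B9Eq335PlaquettesOfRegularCubeZd

/-!
# `Balaban1983to89.B9Eq336OrbitBallProperZd` — [Balaban1985BackgroundPropagators] (3.35)–(3.36) p. 396 AT THE `ℤᵈ × 𝔸` CARRIER: THE REGIME `𝒰′` IS NOT
# EXHAUSTED BY THE `δ`-NEIGHBOURHOODS `𝒩_δ` OF THE PURE-GAUGE ORBIT — a scalar background with constant small curvature in one plane lies in `𝒰′` but in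
# no `𝒩_δ` (`δ` up to the window): closed-loop holonomies of `𝒩_δ` stay `|Γ|·δ`-close to `1` (perimeter), the witness's square holonomy is `e^{iθR²}` (area)

statement-level skeleton of published theorems with citation tags; proofs where landed; nothing here is a claim about the
Yang–Mills mass gap

`[Balaban1985BackgroundPropagators]` ("B9", CMP **99** (1985) 389–434) p. 396: (3.35) the class, (3.36) *«there exists a gauge transformation u defined on □ …
such that U^u = e^{iηA} and |A| < O(1)Mα₀»* — CUBE BY CUBE, not on all of `T_η`; [`Balaban1985Averaging`] (8)–(9) p. 18, (45) p. 24; [`Balaban1985RegularSpaces`]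
(1.7) p. 77, Lemma 1 p. 79 (the axial-gauge bound grows with the box).  PDF held: `paper:balaban1985-cmp99-background-propagators` p. 396.

CITATION HEADER ∕ WHY THIS FILE (cell `pub-ymgap`, HUMAN RULING D-0062 ∕ D-0149; width seat `pub-ymgap-dag-n06-w3` (g4), node N06 = [B9]; CLAIM-6; count-neutral;
a NEGATIVE ∕ LOCATED result in kernel form).  This seat's `B9Thm311SmallFieldPathZd` located, in prose, that the preconnected families it builds (uniform balls
and their gauge translates; `B9Eq336GaugeOrbitConnectedZd`: their union `𝒩_δ`) do not cover the regime `𝒰′` of dag-n06-w2's per-member road, so that the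
continuity method cannot reach all of `𝒰′` through them and the LOCAL-class road of `B9Thm311TouchingClassOfCoerciveZd` (dag-n05-w3's layer gauge ON A BOX +
cut-off + dag-n06-b g20's sides locality) is needed.  THIS FILE proves it: (§1) every closed loop of a background in `𝒩_δ` has holonomy within `|Γ|·δ` of `1`
(gauge conjugation at the base point + four-bond telescoping, dag-n06-w2's `B9Eq315QLipschitz.norm_hol_sub_one_le`); (§2) the scalar background
`U_θ(x, x+e_{j₁}) = e^{iθx_{j₀}}·1` (all other bonds `1`) has every plaquette `|θ|`-close to `1` — so lies in `𝒰′` for `|θ|` below the window — while its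
holonomy around the square of side `R` is `e^{iθR²}·1`; (§3) at the first `R` with `θR² ≥ π∕2` the two bounds collide whenever `4(√(π∕(2θ)) + 1)δ ≤ 1`, in
particular for EVERY `0 < δ ≤ (α_Q∕L²)L^{−2m}` with `θ` half that window.

WHAT IS PROVED (kernel, 0 sorry; two small definitions with body — `phaseUnit`, `witnessCfg` — and theorems; no `instance`, no `notation`).
* §1 `hol_replicate_eq_pow` · ★ `norm_hol_sub_one_le_of_mem_orbitBall` (`U ∈ 𝒩_δ`, `Γ` closed ⟹ `‖U(Γ) − 1‖ ≤ |Γ|δ`).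
* §2 `phaseUnit θ` (def: `e^{iθ}·1`) + `val∕mem∕zero∕add∕neg∕nat_mul`, `norm_phaseUnit_sub_one(_le)` · `witnessCfg j₀ j₁ θ` (def) · `witnessCfg_mem` ·
  ★ `norm_plaqF_witnessCfg_sub_one_le` · ★ `witnessCfg_mem_reg17UnivP` · ★ `hol_witnessCfg_square` (`= e^{iθR²}·1`) · ★★ `witnessCfg_not_mem_orbitBall`.
* §3 `alphaQ_le_small` · ★★★ `exists_mem_reg17UnivP_not_mem_orbitBall` (`d ≥ 2`, `L ≥ 1`, any `m`, EVERY `0 < δ ≤ (α_Q∕L²)L^{−2m}`: `𝒰′ ⊄ 𝒩_δ`).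

HONEST SCOPE.  A NEGATIVE bookkeeping fact about this seat's own families (which sets are connected to which), not an estimate of [B9] and not a claim about
print (print's (3.36) is per cube and is consistent with it); it does NOT say `𝒰′` is disconnected (that stays OPEN); count-neutral; N05 ∕ N06 NOT discharged;
K1⁸ `stmt-QuantumFields-26907` NOT closed; one finite `𝕋⁴` programme at fixed `ε`, Bałaban as printed; R4 closes only the conditional finite-`𝕋⁴` rung
`BalabanLadder.UV` — nothing continuum ∕ ℝ⁴ ∕ OS ∕ mass gap ∕ Clay.  Unit `pub-ymgap-dag-n06-w3` (g4), 2026-08-28.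
-/

noncomputable section

namespace Literature.MathematicalPhysics.QuantumFieldTheory.Balaban1983to89.B9Eq336OrbitBallProperZd

open scoped Real
open Complex
open B7Prop1Explicit
open B7Prop2Explicit (unitaryUnits mem_unitaryUnits unitaryUnits_le_U1)
open B7Eq78Linearization (conjR conjR_sub conjR_one)
open B8Ineq132 (plaqF conjR_units norm_conjR)
open B9Eq316AveragingTransposeZd (Reg17 alphaQ alphaQ_pos)
open B9Eq336GaugeOrbitConnectedZd (smul_mem_unitary)
open B9Eq335PlaquettesOfRegularCubeZd (hol_plaqWord_eq)

-- `Site` alone could resolve to the torus sites of `Setup.lean`; re-export the `ℤ^d` sites of `B7Prop1Explicit`.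
export B7Prop1Explicit (Site)

variable {d : ℕ} {𝔸 : Type*} [CStarAlgebra 𝔸]

/-! ## §1  Closed-loop holonomies of the class `𝒩_δ` are `|Γ|·δ`-close to `1` — LINEARLY in the length of the loop -/

section Loops

/-- holonomy along a straight run of `n` equal letters whose bond variables ALONG THE RUN all equal one fixed `g`: `gⁿ`. [cite: Balaban1985Averaging, (9) p.18 (bookkeeping)] -/
theorem hol_replicate_eq_pow {G : Type*} [Group G] (V : Site d → Fin d → G) (l : Letter d) (g : G) :
    ∀ (n : ℕ) (x : Site d), (∀ j : ℕ, j < n → stepHol V (x + (j : ℤ) • l.vec) l = g) → hol V x (List.replicate n l) = g ^ n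
  | 0, x, _ => by simp
  | n + 1, x, h => by
    have h0 : stepHol V x l = g := by simpa using h 0 (Nat.succ_pos n)
    have h' : ∀ j : ℕ, j < n → stepHol V (x + l.vec + (j : ℤ) • l.vec) l = g := fun j hj => by
      have := h (j + 1) (by omega)
      rwa [Nat.cast_succ, add_smul, one_smul, add_comm ((j : ℤ) • l.vec), ← add_assoc] at this
    rw [List.replicate_succ, hol_cons, h0, hol_replicate_eq_pow V l g n (x + l.vec) h', pow_succ']

variable [Nontrivial 𝔸]

/-- ★ **EVERY CLOSED LOOP OF A BACKGROUND IN `𝒩_δ` HAS HOLONOMY WITHIN `|Γ|·δ` OF `1`** (`0 ≤ δ`): for `U = V^w` with `w` unitary and `V` unitary with all bond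
variables `δ`-close to `1`, the holonomy of `U` around a closed word `Γ` based at `x` is `w(x)V(Γ)w(x)⁻¹`, and `‖V(Γ) − 1‖ ≤ |Γ|·δ` by telescoping
(`B9Eq315QLipschitz.norm_hol_sub_one_le`). The obstruction is LINEAR in the length. [cite: Balaban1985Averaging, (8)–(9) p.18, (45) p.24; Balaban1985BackgroundPropagators, (3.36) p.396] -/
theorem norm_hol_sub_one_le_of_mem_orbitBall {δ : ℝ} {U : Site d → Fin d → 𝔸ˣ}
    (hU : U ∈ {U : Site d → Fin d → 𝔸ˣ | ∃ w : Site d → 𝔸ˣ, (∀ z, w z ∈ unitaryUnits 𝔸) ∧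
      U ∈ (fun V => gaugeAct w V) '' {U : Site d → Fin d → 𝔸ˣ | (∀ x κ, U x κ ∈ unitaryUnits 𝔸) ∧ ∀ x κ, ‖((U x κ : 𝔸ˣ) : 𝔸) - 1‖ < δ}})
    (x : Site d) (Γ : List (Letter d)) (hΓ : disp Γ = 0) :
    ‖((hol U x Γ : 𝔸ˣ) : 𝔸) - 1‖ ≤ Γ.length * δ := by
  obtain ⟨w, hw, V, hV, rfl⟩ := hU
  have h1 : hol (gaugeAct w V) x Γ = w x * hol V x Γ * (w x)⁻¹ := hol_gaugeAct_closed w V x Γ hΓ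
  have h2 : (((hol (gaugeAct w V) x Γ) : 𝔸ˣ) : 𝔸) - 1 = conjR (w x) ((((hol V x Γ) : 𝔸ˣ) : 𝔸) - 1) := by
    rw [h1, conjR_sub, conjR_one, conjR_units]
  rw [h2, norm_conjR (unitaryUnits_le_U1 (hw x))]
  exact B9Eq315QLipschitz.norm_hol_sub_one_le (fun y κ => unitaryUnits_le_U1 (hV.1 y κ)) (fun y κ => (hV.2 y κ).le) x Γ

end Loops

/-! ## §2  The witness: a SCALAR background with constant small curvature in one plane (abelian inside any `𝔸`) -/

section Witness

/-- the unit `e^{iθ}·1` of `𝔸` (a scalar unitary). [cite: Balaban1985Averaging, (23) p.21 («U = Σ_j e^{iλ_j}P_j») (bookkeeping)] -/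
def phaseUnit (θ : ℝ) : 𝔸ˣ :=
  Unitary.toUnits ⟨((Circle.exp θ : ℂ)) • (1 : 𝔸), smul_mem_unitary (Circle.norm_coe _) (one_mem _)⟩

/-- its value. [cite: Balaban1985Averaging, (23) p.21 (bookkeeping)] -/
theorem val_phaseUnit (θ : ℝ) : ((phaseUnit θ : 𝔸ˣ) : 𝔸) = ((Circle.exp θ : ℂ)) • (1 : 𝔸) := rfl

/-- it is unitary. [cite: Balaban1985Averaging, (23) p.21 (bookkeeping)] -/
theorem phaseUnit_mem (θ : ℝ) : (phaseUnit θ : 𝔸ˣ) ∈ unitaryUnits 𝔸 :=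
  smul_mem_unitary (Circle.norm_coe _) (one_mem _)

/-- `e^{i0}·1 = 1`. [cite: Balaban1985Averaging, (23) p.21 (bookkeeping)] -/
theorem phaseUnit_zero : (phaseUnit 0 : 𝔸ˣ) = 1 := by
  apply Units.ext
  rw [val_phaseUnit, Circle.exp_zero, Circle.coe_one, one_smul, Units.val_one]

/-- `e^{i(a+b)}·1 = (e^{ia}·1)(e^{ib}·1)`. [cite: Balaban1985Averaging, (23) p.21 (bookkeeping)] -/
theorem phaseUnit_add (a b : ℝ) : (phaseUnit (a + b) : 𝔸ˣ) = phaseUnit a * phaseUnit b := by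
  apply Units.ext
  rw [Units.val_mul, val_phaseUnit, val_phaseUnit, val_phaseUnit, Circle.exp_add, Circle.coe_mul, smul_mul_smul_comm, mul_one,
    mul_smul]

/-- `(e^{ia}·1)⁻¹ = e^{−ia}·1`. [cite: Balaban1985Averaging, (23) p.21 (bookkeeping)] -/
theorem phaseUnit_neg (a : ℝ) : (phaseUnit (-a) : 𝔸ˣ) = (phaseUnit a)⁻¹ := by
  rw [eq_inv_iff_mul_eq_one, ← phaseUnit_add, neg_add_cancel, phaseUnit_zero]

/-- `e^{ina}·1 = (e^{ia}·1)ⁿ`. [cite: Balaban1985Averaging, (23) p.21 (bookkeeping)] -/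
theorem phaseUnit_nat_mul (a : ℝ) : ∀ n : ℕ, (phaseUnit (n * a) : 𝔸ˣ) = phaseUnit a ^ n
  | 0 => by rw [Nat.cast_zero, zero_mul, phaseUnit_zero, pow_zero]
  | n + 1 => by rw [Nat.cast_succ, add_mul, one_mul, phaseUnit_add, phaseUnit_nat_mul a n, pow_succ]

variable [Nontrivial 𝔸]

/-- `‖e^{iθ}·1 − 1‖ = |e^{iθ} − 1| = 2|sin(θ∕2)|` in a non-trivial C⋆-algebra. [cite: Balaban1985Averaging, (24) p.21 (bookkeeping)] -/
theorem norm_phaseUnit_sub_one (θ : ℝ) : ‖((phaseUnit θ : 𝔸ˣ) : 𝔸) - 1‖ = |2 * Real.sin (θ / 2)| := by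
  rw [val_phaseUnit, ← Complex.norm_exp_I_mul_ofReal_sub_one θ |>.trans (Real.norm_eq_abs _), Circle.coe_exp, mul_comm (θ : ℂ) I]
  have h : (Complex.exp (I * θ)) • (1 : 𝔸) - 1 = (Complex.exp (I * θ) - 1) • (1 : 𝔸) := by rw [sub_smul, one_smul]
  rw [h, norm_smul, norm_one, mul_one]

/-- hence `‖e^{iθ}·1 − 1‖ ≤ |θ|`. [cite: Balaban1985Averaging, (24) p.21] -/
theorem norm_phaseUnit_sub_one_le (θ : ℝ) : ‖((phaseUnit θ : 𝔸ˣ) : 𝔸) - 1‖ ≤ |θ| := by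
  rw [norm_phaseUnit_sub_one, abs_mul, abs_two]
  have h := Real.abs_sin_le_abs (x := θ / 2)
  rw [abs_div, abs_two] at h
  linarith

variable (j₀ j₁ : Fin d)

/-- ★ **THE WITNESS BACKGROUND**: `U_θ(x, x+e_{j₁}) = e^{iθ x_{j₀}}·1`, all other bond variables `1` — a scalar (abelian) background whose `(j₀, j₁)`-plaquettes
are ALL equal to `e^{iθ}·1` and whose other plaquettes are `1`: constant curvature `θ` in one plane, on all of `ℤᵈ`. [cite: Balaban1985BackgroundPropagators, (3.35) p.396 (the class) ; Balaban1985RegularSpaces, (1.7) p.77] -/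
def witnessCfg (θ : ℝ) : Site d → Fin d → 𝔸ˣ := fun x μ => if μ = j₁ then phaseUnit (θ * (x j₀ : ℝ)) else 1

variable {j₀ j₁}

omit [Nontrivial 𝔸] in
/-- the witness is unitary-valued. [cite: Balaban1985RegularSpaces, (1.7) p.77 (bookkeeping)] -/
theorem witnessCfg_mem (θ : ℝ) (x : Site d) (μ : Fin d) : witnessCfg (𝔸 := 𝔸) j₀ j₁ θ x μ ∈ unitaryUnits 𝔸 := by
  unfold witnessCfg; split_ifs
  · exact phaseUnit_mem _
  · exact Subgroup.one_mem _

/-- ★ **EVERY PLAQUETTE OF THE WITNESS IS `|θ|`-CLOSE TO `1`** (`j₀ ≠ j₁`): the `(j₁, ν)`- and `(μ, j₁)`-plaquettes are `e^{∓iθ}·1` or `1`, all others `1`.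
[cite: Balaban1985RegularSpaces, (1.7) p.77; Balaban1985BackgroundPropagators, (3.35) p.396] -/
theorem norm_plaqF_witnessCfg_sub_one_le (hj : j₀ ≠ j₁) (θ : ℝ) (μ ν : Fin d) (hμν : μ ≠ ν) (x : Site d) :
    ‖plaqF (witnessCfg (𝔸 := 𝔸) j₀ j₁ θ) μ ν x - 1‖ ≤ |θ| := by
  have he : ∀ (κ : Fin d) (y : Site d), ((y + e κ) j₀ : ℝ) = (y j₀ : ℝ) + if κ = j₀ then 1 else 0 := by
    intro κ y
    by_cases h : κ = j₀
    · subst h; simp [e]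
    · rw [if_neg h]; simp [e, Ne.symm h]
  unfold plaqF
  rw [hol_plaqWord_eq]
  unfold witnessCfg
  by_cases hμ : μ = j₁
  · subst hμ
    have hν : ν ≠ μ := fun h => hμν h.symm
    simp only [if_true, if_neg hν, mul_one, inv_one]
    -- `e^{iθx₀}·(e^{iθ(x+e_ν)₀})⁻¹ = e^{−iθ[ν = j₀]}`
    rw [he ν x, ← phaseUnit_neg, ← phaseUnit_add]
    have : θ * (x j₀ : ℝ) + -(θ * ((x j₀ : ℝ) + if ν = j₀ then 1 else 0)) = -(θ * if ν = j₀ then 1 else 0) := by ring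
    rw [this]
    refine (norm_phaseUnit_sub_one_le _).trans ?_
    split_ifs <;> simp [abs_nonneg]
  · by_cases hν : ν = j₁
    · subst hν
      simp only [if_neg hμ, if_true, one_mul, inv_one, mul_one]
      rw [he μ x, ← phaseUnit_neg, ← phaseUnit_add]
      have : θ * ((x j₀ : ℝ) + if μ = j₀ then 1 else 0) + -(θ * (x j₀ : ℝ)) = θ * if μ = j₀ then 1 else 0 := by ring
      rw [this]
      refine (norm_phaseUnit_sub_one_le _).trans ?_
      split_ifs <;> simp [abs_nonneg]
    · simp only [if_neg hμ, if_neg hν, mul_one, inv_one, Units.val_one, sub_self, norm_zero]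
      exact abs_nonneg θ

/-- ★ **THE WITNESS LIES IN THE REGIME `𝒰′`** (`j₀ ≠ j₁`, `L ≥ 1`) as soon as `|θ| < (α_Q∕L²)L^{−2m}` (the level-`m` clause is the strongest).
[cite: Balaban1985RegularSpaces, (1.7) p.77] -/
theorem witnessCfg_mem_reg17UnivP (hj : j₀ ≠ j₁) {L : ℕ} (hL : 1 ≤ L) (m : ℕ) {θ : ℝ}
    (hθ : |θ| < alphaQ d L / (L : ℝ) ^ 2 * (((L : ℝ) ^ m)⁻¹) ^ 2) :
    witnessCfg (𝔸 := 𝔸) j₀ j₁ θ ∈ {U₀ : Site d → Fin d → 𝔸ˣ | (∀ x κ, U₀ x κ ∈ unitaryUnits 𝔸) ∧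
        Reg17 L m (fun _ => (Set.univ : Set (Site d))) (alphaQ d L / (L : ℝ) ^ 2) U₀} := by
  refine ⟨fun x κ => witnessCfg_mem θ x κ, fun j hj' x μ ν hμν _ => ?_⟩
  have hα : 0 < alphaQ d L / (L : ℝ) ^ 2 := by
    have := alphaQ_pos d hL
    have hL0 : (0 : ℝ) < L := by exact_mod_cast hL
    positivity
  exact (norm_plaqF_witnessCfg_sub_one_le hj θ μ ν hμν x).trans_lt
    (hθ.trans_le (mul_le_mul_of_nonneg_left (B9Eq17RegimeBallZd.inv_sq_pow_anti hL hj') hα.le))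

omit [Nontrivial 𝔸] in
/-- ★ **THE HOLONOMY OF THE WITNESS AROUND THE SQUARE OF SIDE `R` IN THE `(j₀, j₁)`-PLANE AT THE ORIGIN IS `e^{iθR²}·1`** — QUADRATIC in `R` (the flux through
the square), while §1's bound for `𝒩_δ` is linear in the perimeter `4R`. [cite: Balaban1985Averaging, (9) p.18; Balaban1985RegularSpaces, (1.2) p.76 (bookkeeping)] -/
theorem hol_witnessCfg_square (hj : j₀ ≠ j₁) (θ : ℝ) (R : ℕ) :
    hol (witnessCfg (𝔸 := 𝔸) j₀ j₁ θ) 0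
        (List.replicate R (j₀, true) ++ List.replicate R (j₁, true) ++ List.replicate R (j₀, false) ++ List.replicate R (j₁, false)) =
      phaseUnit (θ * ((R : ℝ) * R)) := by
  have hj' : j₁ ≠ j₀ := fun h => hj h.symm
  have e10 : (e j₁ : Site d) j₀ = 0 := by simp [e, hj]
  have e00 : (e j₀ : Site d) j₀ = 1 := by simp [e]
  -- the four runs
  have sA : ∀ x : Site d, stepHol (witnessCfg (𝔸 := 𝔸) j₀ j₁ θ) x (j₀, true) = 1 := fun x => by
    rw [stepHol_true]; unfold witnessCfg; rw [if_neg hj]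
  have sB : ∀ j : ℕ, j < R → stepHol (witnessCfg (𝔸 := 𝔸) j₀ j₁ θ) ((R : ℤ) • e j₀ + (j : ℤ) • (Letter.vec (j₁, true))) (j₁, true) =
      phaseUnit (θ * R) := fun j _ => by
    rw [stepHol_true]; unfold witnessCfg; rw [if_pos rfl]
    congr 1
    simp [Letter.vec, e10, e00]
  have sC : ∀ x : Site d, stepHol (witnessCfg (𝔸 := 𝔸) j₀ j₁ θ) x (j₀, false) = 1 := fun x => by
    rw [stepHol_false]; unfold witnessCfg; rw [if_neg hj, inv_one]
  have sD : ∀ j : ℕ, j < R → stepHol (witnessCfg (𝔸 := 𝔸) j₀ j₁ θ) ((R : ℤ) • e j₁ + (j : ℤ) • (Letter.vec (j₁, false))) (j₁, false) = 1 :=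
      fun j _ => by
    rw [stepHol_false]; unfold witnessCfg; rw [if_pos rfl]
    have h0 : (((R : ℤ) • e j₁ + (j : ℤ) • Letter.vec ((j₁, false) : Letter d) - e j₁ : Site d) j₀ : ℝ) = 0 := by
      simp [Letter.vec, e10]
    rw [h0, mul_zero, phaseUnit_zero, inv_one]
  -- holonomies of the runs
  have hA : ∀ x : Site d, hol (witnessCfg (𝔸 := 𝔸) j₀ j₁ θ) x (List.replicate R (j₀, true)) = 1 := fun x => by
    rw [hol_replicate_eq_pow _ _ 1 R x (fun j _ => sA _), one_pow]
  have hB : hol (witnessCfg (𝔸 := 𝔸) j₀ j₁ θ) ((R : ℤ) • e j₀) (List.replicate R (j₁, true)) = phaseUnit (θ * ((R : ℝ) * R)) := by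
    rw [hol_replicate_eq_pow _ _ (phaseUnit (θ * R)) R _ sB, ← phaseUnit_nat_mul]
    congr 1; ring
  have hC : ∀ x : Site d, hol (witnessCfg (𝔸 := 𝔸) j₀ j₁ θ) x (List.replicate R (j₀, false)) = 1 := fun x => by
    rw [hol_replicate_eq_pow _ _ 1 R x (fun j _ => sC _), one_pow]
  have hD : hol (witnessCfg (𝔸 := 𝔸) j₀ j₁ θ) ((R : ℤ) • e j₁) (List.replicate R (j₁, false)) = 1 := by
    rw [hol_replicate_eq_pow _ _ 1 R _ sD, one_pow]
  -- displacements
  have dA : disp (List.replicate R ((j₀, true) : Letter d)) = (R : ℤ) • e j₀ := by simp [Letter.vec]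
  have dAB : disp (List.replicate R ((j₀, true) : Letter d) ++ List.replicate R ((j₁, true) : Letter d)) = (R : ℤ) • e j₀ + (R : ℤ) • e j₁ := by
    simp [Letter.vec]
  have dABC : disp (List.replicate R ((j₀, true) : Letter d) ++ List.replicate R ((j₁, true) : Letter d) ++ List.replicate R ((j₀, false) : Letter d)) =
      (R : ℤ) • e j₁ := by
    simp [Letter.vec]
  rw [hol_append, dABC, zero_add, hD, mul_one, hol_append, dAB, zero_add, hC, mul_one, hol_append, dA, zero_add, hA, one_mul, hB]

/-- ★★ **THE WITNESS IS IN NO `𝒩_δ` WITH `4(√(π∕(2θ)) + 1)·δ ≤ 1`** (`0 < θ ≤ 1∕100`, `j₀ ≠ j₁`): at the first `R` with `θR² ≥ π∕2` one has `θR² < π` and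
`R < √(π∕(2θ)) + 1`, so the square holonomy `e^{iθR²}·1` is `≥ √2` away from `1` while §1 allows at most `4Rδ ≤ 1`. The flux through a square grows like
its AREA, the orbit-ball bound like its PERIMETER. [cite: Balaban1985BackgroundPropagators, (3.36) p.396; Balaban1985Averaging, (9) p.18, (45) p.24] -/
theorem witnessCfg_not_mem_orbitBall (hj : j₀ ≠ j₁) {θ : ℝ} (hθ0 : 0 < θ) (hθ1 : θ ≤ 1 / 100) {δ : ℝ} (hδ0 : 0 ≤ δ)
    (hδ : 4 * (Real.sqrt (π / (2 * θ)) + 1) * δ ≤ 1) :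
    witnessCfg (𝔸 := 𝔸) j₀ j₁ θ ∉ {U : Site d → Fin d → 𝔸ˣ | ∃ w : Site d → 𝔸ˣ, (∀ z, w z ∈ unitaryUnits 𝔸) ∧
      U ∈ (fun V => gaugeAct w V) '' {U : Site d → Fin d → 𝔸ˣ | (∀ x κ, U x κ ∈ unitaryUnits 𝔸) ∧ ∀ x κ, ‖((U x κ : 𝔸ˣ) : 𝔸) - 1‖ < δ}} := by
  intro hmem
  -- the first `R` with `π∕2 ≤ θR²`
  have hex : ∃ n : ℕ, π / 2 ≤ θ * ((n : ℝ) * n) := by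
    obtain ⟨n, hn⟩ := exists_nat_gt (π / (2 * θ))
    refine ⟨n, ?_⟩
    have hn1 : (1 : ℝ) ≤ n := by
      have : (0 : ℝ) < n := lt_trans (by positivity) hn
      exact_mod_cast Nat.one_le_iff_ne_zero.2 (by rintro rfl; simp at this)
    have h1 : π / 2 < θ * n := by
      rw [div_lt_iff₀ (by positivity)] at hn
      linarith [mul_comm θ (n : ℝ)]
    have h2 : θ * n ≤ θ * ((n : ℝ) * n) := by
      apply mul_le_mul_of_nonneg_left _ hθ0.le
      nlinarith
    linarith
  classical
  let R : ℕ := Nat.find hex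
  have hR : π / 2 ≤ θ * ((R : ℝ) * R) := Nat.find_spec hex
  have hRpos : 0 < R := by
    by_contra h0
    have hR0 : R = 0 := by omega
    have h := hR
    rw [hR0, Nat.cast_zero, mul_zero, mul_zero] at h
    linarith [Real.pi_pos]
  have hRm : θ * (((R - 1 : ℕ) : ℝ) * ((R - 1 : ℕ) : ℝ)) < π / 2 := by
    have := Nat.find_min hex (show R - 1 < R by omega)
    exact lt_of_not_ge this
  -- `R − 1 < √(π∕(2θ))`, so `R < √(π∕(2θ)) + 1`
  set s : ℝ := Real.sqrt (π / (2 * θ)) with hs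
  have hs0 : 0 ≤ s := Real.sqrt_nonneg _
  have hss : s * s = π / (2 * θ) := by rw [hs, Real.mul_self_sqrt (by positivity)]
  have hR1 : ((R - 1 : ℕ) : ℝ) < s := by
    have hx : ((R - 1 : ℕ) : ℝ) * ((R - 1 : ℕ) : ℝ) < s * s := by
      rw [hss, lt_div_iff₀ (by positivity)]; nlinarith
    have h0 : (0 : ℝ) ≤ ((R - 1 : ℕ) : ℝ) := by positivity
    nlinarith
  have hRs : (R : ℝ) < s + 1 := by
    have : (R : ℝ) = ((R - 1 : ℕ) : ℝ) + 1 := by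
      rw [Nat.cast_sub (by omega)]; push_cast; ring
    linarith
  -- `θR² < 3π∕2`: `θR² = θ(R−1)² + θ(2R − 1)` and `θ(2R−1) ≤ 2θs + θ = 2√(θπ∕2)… ≤ π` for `θ ≤ 1`
  have hup : θ * ((R : ℝ) * R) < 3 * π / 2 := by
    have h1 : θ * ((R : ℝ) * R) = θ * (((R - 1 : ℕ) : ℝ) * ((R - 1 : ℕ) : ℝ)) + θ * (2 * ((R - 1 : ℕ) : ℝ) + 1) := by
      rw [Nat.cast_sub (by omega)]; push_cast; ring
    have h2 : θ * (2 * ((R - 1 : ℕ) : ℝ) + 1) ≤ θ * (2 * s + 1) := by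
      apply mul_le_mul_of_nonneg_left _ hθ0.le; linarith
    -- `(θs)² = θπ∕2 ≤ π∕200 < 1∕25`, so `θs < 1∕5` and `θ(2s + 1) < 1∕2`
    have h3 : (θ * s) * (θ * s) = θ * (π / 2) := by
      calc (θ * s) * (θ * s) = θ * θ * (s * s) := by ring
        _ = θ * (π / 2) := by rw [hss]; field_simp
    have h4 : (θ * s) * (θ * s) < 1 / 25 := by rw [h3]; nlinarith [Real.pi_lt_four]
    have h5 : θ * s < 1 / 5 := by nlinarith [mul_nonneg hθ0.le hs0]
    nlinarith [Real.pi_gt_three]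
  -- hence the square holonomy is far from `1`
  have hfar : 1 < ‖((phaseUnit (θ * ((R : ℝ) * R)) : 𝔸ˣ) : 𝔸) - 1‖ := by
    rw [norm_phaseUnit_sub_one]
    have hlo : π / 4 ≤ θ * ((R : ℝ) * R) / 2 := by linarith
    have hhi : θ * ((R : ℝ) * R) / 2 ≤ 3 * π / 4 := by linarith
    -- `sin ≥ sin(π/4) = √2/2` on `[π/4, 3π/4]`
    have hsin : Real.sqrt 2 / 2 ≤ Real.sin (θ * ((R : ℝ) * R) / 2) := by
      rw [← Real.sin_pi_div_four]
      by_cases hle : θ * ((R : ℝ) * R) / 2 ≤ π / 2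
      · exact Real.sin_le_sin_of_le_of_le_pi_div_two (by linarith [Real.pi_pos]) hle hlo
      · rw [← Real.sin_pi_sub (θ * ((R : ℝ) * R) / 2)]
        exact Real.sin_le_sin_of_le_of_le_pi_div_two (by linarith [Real.pi_pos]) (by linarith) (by linarith)
    have h2 : (1 : ℝ) < Real.sqrt 2 := by
      rw [show (1 : ℝ) = Real.sqrt 1 by simp]
      exact Real.sqrt_lt_sqrt (by norm_num) (by norm_num)
    rw [abs_of_nonneg (by nlinarith [Real.sqrt_nonneg 2])]
    nlinarith [Real.sqrt_nonneg 2]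
  -- … but `𝒩_δ` forces it within `4Rδ ≤ 1`
  have hnear := norm_hol_sub_one_le_of_mem_orbitBall hmem 0
    (List.replicate R (j₀, true) ++ List.replicate R (j₁, true) ++ List.replicate R (j₀, false) ++ List.replicate R (j₁, false))
    (by simp [Letter.vec])
  rw [hol_witnessCfg_square hj θ R] at hnear
  have hlen : ((List.replicate R ((j₀, true) : Letter d) ++ List.replicate R ((j₁, true) : Letter d) ++
      List.replicate R ((j₀, false) : Letter d) ++ List.replicate R ((j₁, false) : Letter d)).length : ℝ) = 4 * R := by
    simp; ring
  rw [hlen] at hnear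
  have : 4 * (R : ℝ) * δ ≤ 4 * (s + 1) * δ := by nlinarith
  linarith

end Witness

/-! ## §3  The regime `𝒰′` is NOT covered by the pure-gauge neighbourhoods `𝒩_δ` -/

section Proper

variable [Nontrivial 𝔸]

/-- `α_Q(d, L) ≤ 1∕1000` (`L ≥ 1`; its third window `1∕(25600(d+1)²(d+4)L^{d+1})`). [cite: Balaban1985Averaging, (145) p.40 (bookkeeping)] -/
theorem alphaQ_le_small (d : ℕ) {L : ℕ} (hL : 1 ≤ L) : alphaQ d L ≤ 1 / 1000 := by
  have hL' : (1 : ℝ) ≤ L := by exact_mod_cast hL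
  have h : alphaQ d L ≤ 1 / (25600 * ((d : ℝ) + 1) ^ 2 * ((d : ℝ) + 4) * (L : ℝ) ^ (d + 1)) := min_le_right _ _
  refine h.trans ?_
  rw [div_le_div_iff₀ (by positivity) (by norm_num)]
  have h1 : (1 : ℝ) ≤ ((d : ℝ) + 1) ^ 2 := one_le_pow₀ (by linarith [Nat.cast_nonneg (α := ℝ) d])
  have h2 : (1 : ℝ) ≤ (L : ℝ) ^ (d + 1) := one_le_pow₀ hL'
  have hd : (0 : ℝ) ≤ d := Nat.cast_nonneg d
  nlinarith [mul_le_mul h1 h2 (by positivity) (by positivity)]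

/-- ★★★ **THE REGIME `𝒰′` IS NOT EXHAUSTED BY THE `δ`-NEIGHBOURHOODS OF THE PURE-GAUGE ORBIT** (`d ≥ 2`, `L ≥ 1`, any `m`): for EVERY `0 < δ ≤ (α_Q∕L²)L^{−2m}` —
in particular every radius of this seat's conditional theorems (`4δ <` that window) — the scalar witness with `θ = (α_Q∕L²)L^{−2m}∕2` lies in `𝒰′` but in no
`𝒩_δ`.  So the preconnected families `(B_δ)^w ∕ 𝒩_δ` of `B9Thm311SmallFieldPathZd` ∕ `B9Eq336GaugeOrbitConnectedZd` do NOT cover the regime, the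
preconnectedness of `𝒰′` itself stays OPEN, and the LOCAL-class road of `B9Thm311TouchingClassOfCoerciveZd` (layer gauge + cut-off + locality) was
necessary, not a convenience — the kernel form of that file's LOCATED note. [cite: Balaban1985BackgroundPropagators, (3.35)–(3.36) p.396, Thm 3.11 p.416; Balaban1985RegularSpaces, (1.7) p.77, Lemma 1 p.79] -/
theorem exists_mem_reg17UnivP_not_mem_orbitBall (hd2 : 2 ≤ d) {L : ℕ} (hL : 1 ≤ L) (m : ℕ) {δ : ℝ} (hδ0 : 0 < δ)
    (hδ : δ ≤ alphaQ d L / (L : ℝ) ^ 2 * (((L : ℝ) ^ m)⁻¹) ^ 2) :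
    ∃ U : Site d → Fin d → 𝔸ˣ,
      U ∈ {U₀ : Site d → Fin d → 𝔸ˣ | (∀ x κ, U₀ x κ ∈ unitaryUnits 𝔸) ∧
          Reg17 L m (fun _ => (Set.univ : Set (Site d))) (alphaQ d L / (L : ℝ) ^ 2) U₀} ∧
      U ∉ {U : Site d → Fin d → 𝔸ˣ | ∃ w : Site d → 𝔸ˣ, (∀ z, w z ∈ unitaryUnits 𝔸) ∧
          U ∈ (fun V => gaugeAct w V) '' {U : Site d → Fin d → 𝔸ˣ | (∀ x κ, U x κ ∈ unitaryUnits 𝔸) ∧ ∀ x κ, ‖((U x κ : 𝔸ˣ) : 𝔸) - 1‖ < δ}} := by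
  set ω : ℝ := alphaQ d L / (L : ℝ) ^ 2 * (((L : ℝ) ^ m)⁻¹) ^ 2 with hω
  have hL' : (1 : ℝ) ≤ L := by exact_mod_cast hL
  have hω0 : 0 < ω := by have := alphaQ_pos d hL; positivity
  -- `ω ≤ α_Q ≤ 1∕1000`
  have hω1 : ω ≤ 1 / 1000 := by
    have h1 : alphaQ d L / (L : ℝ) ^ 2 ≤ alphaQ d L := div_le_self (alphaQ_pos d hL).le (one_le_pow₀ hL')
    have h2 : (((L : ℝ) ^ m)⁻¹) ^ 2 ≤ 1 := pow_le_one₀ (by positivity) (inv_le_one_of_one_le₀ (one_le_pow₀ hL'))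
    calc ω = alphaQ d L / (L : ℝ) ^ 2 * (((L : ℝ) ^ m)⁻¹) ^ 2 := hω
      _ ≤ alphaQ d L * 1 := mul_le_mul h1 h2 (by positivity) (alphaQ_pos d hL).le
      _ ≤ 1 / 1000 := by rw [mul_one]; exact alphaQ_le_small d hL
  let j₀ : Fin d := ⟨0, by omega⟩
  let j₁ : Fin d := ⟨1, by omega⟩
  have hj : j₀ ≠ j₁ := by simp [j₀, j₁, Fin.ext_iff]
  refine ⟨witnessCfg j₀ j₁ (ω / 2), witnessCfg_mem_reg17UnivP hj hL m (by rw [abs_of_pos (by positivity)]; linarith),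
    witnessCfg_not_mem_orbitBall hj (by positivity) (by linarith) hδ0.le ?_⟩
  -- `√(π∕ω) ≤ 1∕(10ω)` (as `100πω ≤ 1`), so `4(√(π∕ω) + 1)δ ≤ 4(1∕(10ω) + 1)ω = 2∕5 + 4ω ≤ 1`
  have hθ : π / (2 * (ω / 2)) = π / ω := by congr 1; ring
  rw [hθ]
  have hsq : Real.sqrt (π / ω) ≤ 1 / (10 * ω) := by
    rw [Real.sqrt_le_iff]
    refine ⟨by positivity, ?_⟩
    rw [div_pow, one_pow, div_le_div_iff₀ hω0 (by positivity)]
    nlinarith [Real.pi_lt_four]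
  calc 4 * (Real.sqrt (π / ω) + 1) * δ ≤ 4 * (1 / (10 * ω) + 1) * ω := by
        apply mul_le_mul (mul_le_mul_of_nonneg_left (by linarith) (by norm_num)) hδ hδ0.le (by positivity)
    _ = 2 / 5 + 4 * ω := by field_simp; ring
    _ ≤ 1 := by linarith

end Proper

end Literature.MathematicalPhysics.QuantumFieldTheory.Balaban1983to89.B9Eq336OrbitBallProperZd

end
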